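import Summits.ResolutionOfSingularities.ResolutionOfSingularities.Theorems.RadicialJungCleanModelsPBasisDualDerivations
import HarnessLib

/-!
# Route `RadicialJung`, crux `CleanModels` (stmt-15917): Giraud's log-content ideals read on a
# `p`-basis — `J(R, f; log x)`, `J(R, f; log x, log y)`, `J(R, f)` in terms of the dual derivations

Support file (OURS; general algebra in characteristic `p`) for PROGRAMME-clean-dim2 (T2, W8.1), the
bridge between the intrinsic (derivation-form) content ideals of
`Literature/AlgebraicGeometry/Resolution/GiraudLogJacobianIdeal.lean` /
`RadicialJungCleanModelsLogContentIdeal*.lean` and the `p`-basis computation of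
`RadicialJungCleanModelsGiraudExactness.lean`. For a ring `R` of characteristic `p`, a `p`-basis
`Γ` of `R` over `R^p` (Kimura–Niitsuma, possibly infinite) containing `x ≠ y`, and dual derivations
`δ_γ` (`Literature.RingTheory.PBasis.IsPBasisOver.exists_dual_derivation_frobenius`), Giraud's
generators 1.1 (2)–(3) ("engendré par les `x_i ∂f/∂x_i` tels que `a(i) ≠ 0` et les `∂f/∂x_j` tels
que `a(j) = 0`") hold verbatim:

* `span_logDerivation_apply_eq_span_dual` — `{D f : x ∣ D x}` spans `(x δ_x f, δ_y f) + (δ_u f)`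
  (`E = div(x)`);
* `span_logDerivation₂_apply_eq_span_dual` — `{D f : x ∣ D x, y ∣ D y}` spans
  `(x δ_x f, y δ_y f) + (δ_u f)` (`E = div(xy)`);
* `span_derivation_apply_eq_span_dual` — `{D f}` spans `(δ_x f, δ_y f) + (δ_u f)` (`J(X, f)`);

all from `derivation_apply_eq_sum_mul_dual` (`D f = Σ_{γ} D(γ) δ_γ f`) of
`RadicialJungCleanModelsPBasisDualDerivations.lean`, which also has the case
`N(R, f; x, y) = (δ_u f)` (`span_nullDerivation_apply_eq_span_dual`).

References: J. Giraud, Bull. SMF 111 (1983), 1.1 (2)–(3) [Giraud1983]; H. Matsumura, Commutative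
Ring Theory, Thm. 30.5 [Matsumura1987]. Nothing here is a statement of Hironaka's manuscript or
bears on the summit directly.
-/

noncomputable section

set_option linter.dupNamespace false -- mandated namespace of this single-conjunct summit

open Literature.RingTheory.PBasis

namespace Summit.ResolutionOfSingularities.ResolutionOfSingularities.Theorems.RadicialJung.CleanModels

universe u

variable {p : ℕ} [Fact p.Prime] {R : Type u} [CommRing R] [CharP R p] {Γ : Set R}
  (δ : Γ → Derivation ℤ R R) (hδ₁ : ∀ γ : Γ, δ γ (γ : R) = 1)
  (hδ₀ : ∀ γ γ' : Γ, γ' ≠ γ → δ γ (γ' : R) = 0) {x y : R} (hx : x ∈ Γ) (hy : y ∈ Γ)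

include hδ₁ hδ₀ hx hy in
/-- **`J(R, f; log x) = (x δ_x f, δ_y f) + (δ_u f : u ∈ Γ ∖ {x, y})`**: the values `D f` of the
derivations logarithmic along `x` (`x ∣ D x`) span the same ideal as `x δ_x f`, `δ_y f` and the
`δ_u f` — the generators "`x f′_x, f′_y, f′_{u_i}`" of Giraud's `J(X, f, E)` for `E = div(x)`.
[cite: Giraud1983, 1.1 (3)] -/
theorem span_logDerivation_apply_eq_span_dual (h : IsPBasisOver p (frobenius R p).range Γ)
    (hxy : x ≠ y) (f : R) :
    Ideal.span {v : R | ∃ D : Derivation ℤ R R, x ∣ D x ∧ D f = v} =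
      Ideal.span ({x * δ ⟨x, hx⟩ f, δ ⟨y, hy⟩ f} ∪
        {v : R | ∃ γ : Γ, (γ : R) ≠ x ∧ (γ : R) ≠ y ∧ δ γ f = v}) := by
  classical
  apply le_antisymm
  · rw [Ideal.span_le]
    rintro _ ⟨D, ⟨a, ha⟩, rfl⟩
    obtain ⟨F, hF⟩ := derivation_apply_eq_sum_mul_dual δ hδ₁ hδ₀ h f
    rw [SetLike.mem_coe, hF D]
    refine Ideal.sum_mem _ fun γ _ => ?_
    by_cases hγx : (γ : R) = x
    · have hγ : γ = ⟨x, hx⟩ := Subtype.ext hγx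
      rw [hγ]
      change D x * δ ⟨x, hx⟩ f ∈ _
      rw [ha, mul_comm x a, mul_assoc]
      exact Ideal.mul_mem_left _ a (Ideal.subset_span (Or.inl (Or.inl rfl)))
    by_cases hγy : (γ : R) = y
    · have hγ : γ = ⟨y, hy⟩ := Subtype.ext hγy
      rw [hγ]
      exact Ideal.mul_mem_left _ _ (Ideal.subset_span (Or.inl (Or.inr rfl)))
    exact Ideal.mul_mem_left _ _ (Ideal.subset_span (Or.inr ⟨γ, hγx, hγy, rfl⟩))
  · rw [Ideal.span_le]
    rintro v (hv | ⟨γ, hγx, hγy, rfl⟩)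
    · simp only [Set.mem_insert_iff, Set.mem_singleton_iff] at hv
      rcases hv with rfl | rfl
      · -- `x δ_x` is logarithmic: `(x δ_x) x = x`
        have h1 : δ ⟨x, hx⟩ x = 1 := hδ₁ ⟨x, hx⟩
        refine Ideal.subset_span ⟨x • δ ⟨x, hx⟩, ?_, by simp [smul_eq_mul]⟩
        rw [Derivation.smul_apply, smul_eq_mul, h1, mul_one]
      · have h0 : δ ⟨y, hy⟩ x = 0 := hδ₀ ⟨y, hy⟩ ⟨x, hx⟩ (fun e => hxy (congrArg Subtype.val e))
        refine Ideal.subset_span ⟨δ ⟨y, hy⟩, ?_, rfl⟩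
        rw [h0]; exact dvd_zero x
    · have h0 : δ γ x = 0 := hδ₀ γ ⟨x, hx⟩ (fun e => hγx (by rw [← e]))
      refine Ideal.subset_span ⟨δ γ, ?_, rfl⟩
      rw [h0]; exact dvd_zero x

include hδ₁ hδ₀ hx hy in
/-- **`J(R, f; log x, log y) = (x δ_x f, y δ_y f) + (δ_u f : u ∈ Γ ∖ {x, y})`** (the crossing case
`E = div(xy)`: derivations logarithmic along `x` and `y`). [cite: Giraud1983, 1.1 (3)] -/
theorem span_logDerivation₂_apply_eq_span_dual (h : IsPBasisOver p (frobenius R p).range Γ)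
    (hxy : x ≠ y) (f : R) :
    Ideal.span {v : R | ∃ D : Derivation ℤ R R, x ∣ D x ∧ y ∣ D y ∧ D f = v} =
      Ideal.span ({x * δ ⟨x, hx⟩ f, y * δ ⟨y, hy⟩ f} ∪
        {v : R | ∃ γ : Γ, (γ : R) ≠ x ∧ (γ : R) ≠ y ∧ δ γ f = v}) := by
  classical
  have hx1 : δ ⟨x, hx⟩ x = 1 := hδ₁ ⟨x, hx⟩
  have hy1 : δ ⟨y, hy⟩ y = 1 := hδ₁ ⟨y, hy⟩
  have hxy0 : δ ⟨x, hx⟩ y = 0 := hδ₀ ⟨x, hx⟩ ⟨y, hy⟩ (fun e => hxy (congrArg Subtype.val e).symm)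
  have hyx0 : δ ⟨y, hy⟩ x = 0 := hδ₀ ⟨y, hy⟩ ⟨x, hx⟩ (fun e => hxy (congrArg Subtype.val e))
  apply le_antisymm
  · rw [Ideal.span_le]
    rintro _ ⟨D, ⟨a, ha⟩, ⟨b, hb⟩, rfl⟩
    obtain ⟨F, hF⟩ := derivation_apply_eq_sum_mul_dual δ hδ₁ hδ₀ h f
    rw [SetLike.mem_coe, hF D]
    refine Ideal.sum_mem _ fun γ _ => ?_
    by_cases hγx : (γ : R) = x
    · have hγ : γ = ⟨x, hx⟩ := Subtype.ext hγx
      rw [hγ]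
      change D x * δ ⟨x, hx⟩ f ∈ _
      rw [ha, mul_comm x a, mul_assoc]
      exact Ideal.mul_mem_left _ a (Ideal.subset_span (Or.inl (Or.inl rfl)))
    by_cases hγy : (γ : R) = y
    · have hγ : γ = ⟨y, hy⟩ := Subtype.ext hγy
      rw [hγ]
      change D y * δ ⟨y, hy⟩ f ∈ _
      rw [hb, mul_comm y b, mul_assoc]
      exact Ideal.mul_mem_left _ b (Ideal.subset_span (Or.inl (Or.inr rfl)))
    exact Ideal.mul_mem_left _ _ (Ideal.subset_span (Or.inr ⟨γ, hγx, hγy, rfl⟩))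
  · rw [Ideal.span_le]
    rintro v (hv | ⟨γ, hγx, hγy, rfl⟩)
    · simp only [Set.mem_insert_iff, Set.mem_singleton_iff] at hv
      rcases hv with rfl | rfl
      · refine Ideal.subset_span ⟨x • δ ⟨x, hx⟩, ?_, ?_, by simp [smul_eq_mul]⟩
        · rw [Derivation.smul_apply, smul_eq_mul, hx1, mul_one]
        · rw [Derivation.smul_apply, smul_eq_mul, hxy0, mul_zero]; exact dvd_zero y
      · refine Ideal.subset_span ⟨y • δ ⟨y, hy⟩, ?_, ?_, by simp [smul_eq_mul]⟩
        · rw [Derivation.smul_apply, smul_eq_mul, hyx0, mul_zero]; exact dvd_zero x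
        · rw [Derivation.smul_apply, smul_eq_mul, hy1, mul_one]
    · have h0x : δ γ x = 0 := hδ₀ γ ⟨x, hx⟩ (fun e => hγx (by rw [← e]))
      have h0y : δ γ y = 0 := hδ₀ γ ⟨y, hy⟩ (fun e => hγy (by rw [← e]))
      refine Ideal.subset_span ⟨δ γ, ?_, ?_, rfl⟩
      · rw [h0x]; exact dvd_zero x
      · rw [h0y]; exact dvd_zero y

include hδ₁ hδ₀ hx hy in
/-- **`J(R, f) = (δ_x f, δ_y f) + (δ_u f : u ∈ Γ ∖ {x, y})`**: the values `D f` of ALL derivations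
span the same ideal as the values of the dual derivations (Giraud's `J(X, f)`, whose height-one
primes are the branches of `E(f)`). [cite: Giraud1983, 1.1 (2)] -/
theorem span_derivation_apply_eq_span_dual (h : IsPBasisOver p (frobenius R p).range Γ) (f : R) :
    Ideal.span (Set.range fun D : Derivation ℤ R R => D f) =
      Ideal.span ({δ ⟨x, hx⟩ f, δ ⟨y, hy⟩ f} ∪
        {v : R | ∃ γ : Γ, (γ : R) ≠ x ∧ (γ : R) ≠ y ∧ δ γ f = v}) := by
  classical
  apply le_antisymm
  · rw [Ideal.span_le]
    rintro _ ⟨D, rfl⟩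
    obtain ⟨F, hF⟩ := derivation_apply_eq_sum_mul_dual δ hδ₁ hδ₀ h f
    rw [SetLike.mem_coe]
    change D f ∈ _
    rw [hF D]
    refine Ideal.sum_mem _ fun γ _ => ?_
    by_cases hγx : (γ : R) = x
    · have hγ : γ = ⟨x, hx⟩ := Subtype.ext hγx
      rw [hγ]
      exact Ideal.mul_mem_left _ _ (Ideal.subset_span (Or.inl (Or.inl rfl)))
    by_cases hγy : (γ : R) = y
    · have hγ : γ = ⟨y, hy⟩ := Subtype.ext hγy
      rw [hγ]
      exact Ideal.mul_mem_left _ _ (Ideal.subset_span (Or.inl (Or.inr rfl)))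
    exact Ideal.mul_mem_left _ _ (Ideal.subset_span (Or.inr ⟨γ, hγx, hγy, rfl⟩))
  · rw [Ideal.span_le]
    rintro v (hv | ⟨γ, -, -, rfl⟩)
    · simp only [Set.mem_insert_iff, Set.mem_singleton_iff] at hv
      rcases hv with rfl | rfl
      · exact Ideal.subset_span ⟨δ ⟨x, hx⟩, rfl⟩
      · exact Ideal.subset_span ⟨δ ⟨y, hy⟩, rfl⟩
    · exact Ideal.subset_span ⟨δ γ, rfl⟩

end Summit.ResolutionOfSingularities.ResolutionOfSingularities.Theorems.RadicialJung.CleanModels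

end
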